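import Summits.RiemannHypothesis.RiemannHypothesis.Theorems.WeilFormatCDigammaQuarterExpansion
import Summits.RiemannHypothesis.RiemannHypothesis.Theorems.WeilFormatCArchNodeSumExpansion
import HarnessLib

/-!
# Format C, design C∞: the archimedean families `J_s(m)`, `J_c(m)` expanded in powers of `1/m` to ANY order

Route context: Fourier–Galerkin / Schur-complement certificates of Weil positivity on a window ("format C";
cell memo `run/shared/lean/pub/rh-explicit/rh-explicit-weil-10/KERNEL-LEVER.md` §20; supporting stmt-RiemannHypothesis-0098;
seat rh-explicit-weil-10).  Assembly of `WeilFormatCDigammaQuarterExpansion` (`ψ(¼ + iy)` in powers of `t = 1/(4y)`) and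
`WeilFormatCArchNodeSumExpansion` (the node sums `T_s`, `T_c` in powers of `1/ω`) into the two archimedean families of the C∞
images (`WeilFormatCPolyWindowMixedRealFamilies`): with `ω = ω_m = πm/a ≥ 2`, `y = ω/2`, `t = 1/(2ω)`,

* `abs_setIntegral_sin_sub_expansion_le` — `J_s(m) = ∫_{(0,2a]} ρ sin(ω t) = ½ Im E_{ν,K}(t) − Σ_{r<R} (−1)^r D_{2r}/ω^{2r+1} + err`,
  `|err| ≤ ½ Rem_{ν,K}(t) + D_{2R}/ω^{2R+1}`;
* `abs_setIntegral_one_sub_cos_sub_expansion_le` —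
  `J_c(m) = ∫_{(0,2a]} ρ (1 − cos ωt) = ½(Re E_{ν,K}(t) − ψ(¼)) − Σ_k e^{−2al_k}/l_k + Σ_{r<R} (−1)^r D_{2r+1}/ω^{2r+2} + err`,
  `|err| ≤ ½ Rem_{ν,K}(t) + D_{2R+1}/ω^{2R+2}`,

where `E_{ν,K}(t)` is the explicit complex polynomial of `norm_digamma_quarter_sub_expansion_le` (its real and imaginary parts are
read off with `re_I_mul_ofReal_pow` / `im_I_mul_ofReal_pow` / `I_pow_eq_I_pow_mod_four`), `Rem_{ν,K}` its explicit remainder, and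
`D_s = Σ_k e^{−2al_k} l_k^s` the node moments (enclosures: `tsum_exp_mul_node_pow_sub_sum_le`).  So the deviations
`J_s − π/4` and `J_c − ½ log m − κ(a)` become polynomials in `1/m` with explicit coefficients plus `O(m^{−K−1})`: the `δ/ε` families of
the structured tail disappear into the pure-power families (weil-2 gen9 `famexp` design).

Also `modeFunction_eq_setIntegral_sin_add`: the block rows' mode function `½Y_m + S_m − T_m` IS `F_m` (rows and images share it), and
the parities in `ω` (`J_s`, `S` odd; `J_c`, `C` even) that reduce the negative modes `χ_{−m}` to `ω ≥ 2`.

Standard axioms; no definitions; no RH claim.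
-/

set_option autoImplicit false
-- `Summit.RiemannHypothesis.RiemannHypothesis.…` is the layout-mandated namespace (summit = problem name).
set_option linter.dupNamespace false

noncomputable section

open Complex Filter Set MeasureTheory
open scoped Real Topology ArithmeticFunction.vonMangoldt

namespace Summit.RiemannHypothesis.RiemannHypothesis.Theorems.WeilFormatC

open Literature.NumberTheory.LFunctions Literature.NumberTheory.LFunctions.Yoshida1992
  Literature.Analysis.SpecialFunctions

variable {a : ℝ}

/-- **`J_s(m)` to any order** (`a > 0`, `m : ℤ` with `ω = πm/a ≥ 2`; `ν ≥ 1`, `2ν ≤ K`, any `R`; `t = 1/(2ω)`). -/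
theorem abs_setIntegral_sin_sub_expansion_le (ha : 0 < a) {m : ℤ} (hm : 2 ≤ π * m / a) {ν : ℕ} (hν : ν ≠ 0) {K : ℕ}
    (hK : 2 * ν ≤ K) (R : ℕ) :
    |(∫ t in Ioc 0 (2 * a), weilArchDensity t * Real.sin (π * m / a * t))
        - (((Real.log (π * m / a / 2) : ℂ) + ((π / 2 : ℝ) : ℂ) * I
              - ∑ n ∈ Finset.Icc 1 K, (I * ((1 / (4 * (π * m / a / 2)) : ℝ) : ℂ)) ^ n / (n : ℂ)
              + 2 * ∑ n ∈ Finset.range K, (I * ((1 / (4 * (π * m / a / 2)) : ℝ) : ℂ)) ^ (n + 1)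
              - ∑ k ∈ Finset.Icc 1 ν, (bernoulli (2 * k) : ℂ) / (2 * k) * 16 ^ k *
                  ∑ n ∈ Finset.range (K - 2 * k + 1), ((n + (2 * k - 1)).choose (2 * k - 1) : ℂ) *
                    (I * ((1 / (4 * (π * m / a / 2)) : ℝ) : ℂ)) ^ (n + 2 * k)).im / 2
            - ∑ r ∈ Finset.range R, (-1 : ℝ) ^ r *
                (∑' k : ℕ, Real.exp (-(2 * a * digammaNode k)) * digammaNode k ^ (2 * r)) / (π * m / a) ^ (2 * r + 1))|
      ≤ (4 * Real.pi ^ 2 / 3 * ((2 * ν + 1).factorial : ℝ) / (2 * Real.pi) ^ (2 * ν + 1)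
            * (4 * (1 / (4 * (π * m / a / 2)))) ^ (2 * ν)
          + (1 / (4 * (π * m / a / 2))) ^ (K + 1) / ((K + 1) * (1 - 1 / (4 * (π * m / a / 2))))
          + 2 * (1 / (4 * (π * m / a / 2))) ^ (K + 1)
          + ∑ k ∈ Finset.Icc 1 ν, |(bernoulli (2 * k) : ℝ) / (2 * k)| * 2 ^ (K + 1 + 4 * k)
              * (1 / (4 * (π * m / a / 2))) ^ (K + 1)) / 2
        + (∑' k : ℕ, Real.exp (-(2 * a * digammaNode k)) * digammaNode k ^ (2 * R)) / |π * m / a| ^ (2 * R + 1) := by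
  set ω : ℝ := π * m / a with hω
  have hω0 : ω ≠ 0 := by intro h; rw [h] at hm; linarith
  have hy : 1 ≤ ω / 2 := by linarith
  rw [setIntegral_weilArchDensity_mul_sin ha m, ← hω]
  have hE := norm_digamma_quarter_sub_expansion_le hy hν hK
  have hT := abs_nodeSumSin_sub_sum_le ha hω0 R
  have ecast : (1 / 4 : ℂ) + ((ω : ℝ) : ℂ) / 2 * I = 1 / 4 + (((ω / 2 : ℝ)) : ℂ) * I := by push_cast; ring
  rw [ecast]
  -- abbreviate the pieces
  set ψv := Complex.digamma (1 / 4 + (((ω / 2 : ℝ)) : ℂ) * I) with hψv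
  set E := ((Real.log (ω / 2) : ℂ) + ((π / 2 : ℝ) : ℂ) * I
      - ∑ n ∈ Finset.Icc 1 K, (I * ((1 / (4 * (ω / 2)) : ℝ) : ℂ)) ^ n / (n : ℂ)
      + 2 * ∑ n ∈ Finset.range K, (I * ((1 / (4 * (ω / 2)) : ℝ) : ℂ)) ^ (n + 1)
      - ∑ k ∈ Finset.Icc 1 ν, (bernoulli (2 * k) : ℂ) / (2 * k) * 16 ^ k *
          ∑ n ∈ Finset.range (K - 2 * k + 1), ((n + (2 * k - 1)).choose (2 * k - 1) : ℂ) *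
            (I * ((1 / (4 * (ω / 2)) : ℝ) : ℂ)) ^ (n + 2 * k)) with hEdef
  set Ts := ∑' k : ℕ, Real.exp (-(2 * a * digammaNode k)) * (ω / (digammaNode k ^ 2 + ω ^ 2)) with hTs
  set Sr := ∑ r ∈ Finset.range R, (-1 : ℝ) ^ r *
      (∑' k : ℕ, Real.exp (-(2 * a * digammaNode k)) * digammaNode k ^ (2 * r)) / ω ^ (2 * r + 1) with hSr
  have him : |ψv.im - E.im| ≤ ‖ψv - E‖ := by
    rw [← Complex.sub_im]; exact Complex.abs_im_le_norm _
  have e : ψv.im / 2 - Ts - (E.im / 2 - Sr) = (ψv.im - E.im) / 2 - (Ts - Sr) := by ring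
  rw [e]
  calc |(ψv.im - E.im) / 2 - (Ts - Sr)| ≤ |(ψv.im - E.im) / 2| + |Ts - Sr| := abs_sub _ _
    _ = |ψv.im - E.im| / 2 + |Ts - Sr| := by rw [abs_div, abs_two]
    _ ≤ ‖ψv - E‖ / 2 + |Ts - Sr| := by gcongr
    _ ≤ _ := add_le_add (div_le_div_of_nonneg_right hE (by norm_num)) hT

/-- **`J_c(m)` to any order** (`a > 0`, `m : ℤ` with `ω = πm/a ≥ 2`; `ν ≥ 1`, `2ν ≤ K`, any `R`; `t = 1/(2ω)`):
the main part is `½(Re E_{ν,K}(t) − Re ψ(¼)) − Σ_k e^{−2al_k}/l_k + Σ_{r<R} (−1)^r D_{2r+1}/ω^{2r+2}`. -/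
theorem abs_setIntegral_one_sub_cos_sub_expansion_le (ha : 0 < a) {m : ℤ} (hm : 2 ≤ π * m / a) {ν : ℕ} (hν : ν ≠ 0)
    {K : ℕ} (hK : 2 * ν ≤ K) (R : ℕ) :
    |(∫ t in Ioc 0 (2 * a), weilArchDensity t * (1 - Real.cos (π * m / a * t)))
        - (((Real.log (π * m / a / 2) : ℂ) + ((π / 2 : ℝ) : ℂ) * I
              - ∑ n ∈ Finset.Icc 1 K, (I * ((1 / (4 * (π * m / a / 2)) : ℝ) : ℂ)) ^ n / (n : ℂ)
              + 2 * ∑ n ∈ Finset.range K, (I * ((1 / (4 * (π * m / a / 2)) : ℝ) : ℂ)) ^ (n + 1)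
              - ∑ k ∈ Finset.Icc 1 ν, (bernoulli (2 * k) : ℂ) / (2 * k) * 16 ^ k *
                  ∑ n ∈ Finset.range (K - 2 * k + 1), ((n + (2 * k - 1)).choose (2 * k - 1) : ℂ) *
                    (I * ((1 / (4 * (π * m / a / 2)) : ℝ) : ℂ)) ^ (n + 2 * k)).re / 2
            - reDigammaQuarter 0 / 2
            - (∑' k : ℕ, Real.exp (-(2 * a * digammaNode k)) / digammaNode k)
            + ∑ r ∈ Finset.range R, (-1 : ℝ) ^ r *
                (∑' k : ℕ, Real.exp (-(2 * a * digammaNode k)) * digammaNode k ^ (2 * r + 1)) / (π * m / a) ^ (2 * r + 2))|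
      ≤ (4 * Real.pi ^ 2 / 3 * ((2 * ν + 1).factorial : ℝ) / (2 * Real.pi) ^ (2 * ν + 1)
            * (4 * (1 / (4 * (π * m / a / 2)))) ^ (2 * ν)
          + (1 / (4 * (π * m / a / 2))) ^ (K + 1) / ((K + 1) * (1 - 1 / (4 * (π * m / a / 2))))
          + 2 * (1 / (4 * (π * m / a / 2))) ^ (K + 1)
          + ∑ k ∈ Finset.Icc 1 ν, |(bernoulli (2 * k) : ℝ) / (2 * k)| * 2 ^ (K + 1 + 4 * k)
              * (1 / (4 * (π * m / a / 2))) ^ (K + 1)) / 2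
        + (∑' k : ℕ, Real.exp (-(2 * a * digammaNode k)) * digammaNode k ^ (2 * R + 1)) / |π * m / a| ^ (2 * R + 2) := by
  set ω : ℝ := π * m / a with hω
  have hω0 : ω ≠ 0 := by intro h; rw [h] at hm; linarith
  have hy : 1 ≤ ω / 2 := by linarith
  rw [setIntegral_weilArchDensity_mul_one_sub_cos ha m, ← hω, tsum_exp_mul_digammaTerm_div_two_eq ha ω]
  have hE := norm_digamma_quarter_sub_expansion_le hy hν hK
  have hT := abs_nodeSumCos_sub_sum_le ha hω0 R
  -- `reDigammaQuarter ω = Re ψ(¼ + i(ω/2))`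
  have hX : reDigammaQuarter ω = (Complex.digamma (1 / 4 + (((ω / 2 : ℝ)) : ℂ) * I)).re := by
    unfold reDigammaQuarter
    congr 3
    push_cast
    ring
  rw [hX]
  set ψv := Complex.digamma (1 / 4 + (((ω / 2 : ℝ)) : ℂ) * I) with hψv
  set E := ((Real.log (ω / 2) : ℂ) + ((π / 2 : ℝ) : ℂ) * I
      - ∑ n ∈ Finset.Icc 1 K, (I * ((1 / (4 * (ω / 2)) : ℝ) : ℂ)) ^ n / (n : ℂ)
      + 2 * ∑ n ∈ Finset.range K, (I * ((1 / (4 * (ω / 2)) : ℝ) : ℂ)) ^ (n + 1)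
      - ∑ k ∈ Finset.Icc 1 ν, (bernoulli (2 * k) : ℂ) / (2 * k) * 16 ^ k *
          ∑ n ∈ Finset.range (K - 2 * k + 1), ((n + (2 * k - 1)).choose (2 * k - 1) : ℂ) *
            (I * ((1 / (4 * (ω / 2)) : ℝ) : ℂ)) ^ (n + 2 * k)) with hEdef
  set Tc := ∑' k : ℕ, Real.exp (-(2 * a * digammaNode k)) * (digammaNode k / (digammaNode k ^ 2 + ω ^ 2)) with hTc
  set Sr := ∑ r ∈ Finset.range R, (-1 : ℝ) ^ r *
      (∑' k : ℕ, Real.exp (-(2 * a * digammaNode k)) * digammaNode k ^ (2 * r + 1)) / ω ^ (2 * r + 2) with hSr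
  set D := ∑' k : ℕ, Real.exp (-(2 * a * digammaNode k)) / digammaNode k with hD
  set X0 := reDigammaQuarter 0 with hX0
  have hre : |ψv.re - E.re| ≤ ‖ψv - E‖ := by
    rw [← Complex.sub_re]; exact Complex.abs_re_le_norm _
  have e : (ψv.re - X0) / 2 - (D - Tc) - (E.re / 2 - X0 / 2 - D + Sr) = (ψv.re - E.re) / 2 + (Tc - Sr) := by ring
  rw [e]
  calc |(ψv.re - E.re) / 2 + (Tc - Sr)| ≤ |(ψv.re - E.re) / 2| + |Tc - Sr| := abs_add_le _ _
    _ = |ψv.re - E.re| / 2 + |Tc - Sr| := by rw [abs_div, abs_two]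
    _ ≤ ‖ψv - E‖ / 2 + |Tc - Sr| := by gcongr
    _ ≤ _ := add_le_add (div_le_div_of_nonneg_right hE (by norm_num)) hT

/-! ## The rows' mode function is the images' `F_m` -/

/-- **Rows and images share `F_m`**: the mode function of the block rows (`WeilFormatCTailEvenJ`, `WeilFormatCColumnKernel`),
`½ Im ψ(¼ + iω_m/2) + S_m − T_m` with `T_m = archExpSumSin a m`, equals the images' `F_m = J_s(m) + S_m`
(`J_s(m) = ∫_{(0,2a]} ρ sin(ω_m t)`), for every natural `m`. -/
theorem modeFunction_eq_setIntegral_sin_add (ha : 0 < a) (m : ℕ) :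
    (Complex.digamma (1 / 4 + ((freq a m : ℝ) : ℂ) / 2 * I)).im / 2
        + (∑ k ∈ weilPrimeIndex a, (Λ k : ℝ) / Real.sqrt k * Real.sin (freq a m * Real.log k)) - archExpSumSin a m
      = (∫ t in Ioc 0 (2 * a), weilArchDensity t * Real.sin (π * m / a * t))
        + ∑ n ∈ weilPrimeIndex a, (Λ n : ℝ) / Real.sqrt n * Real.sin (π * m / a * Real.log n) := by
  have h := setIntegral_weilArchDensity_mul_sin ha (m : ℤ)
  rw [Int.cast_natCast] at h
  rw [h]
  unfold archExpSumSin
  rw [freq_natCast]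
  ring

/-! ## Parity in the frequency (negative modes) -/

/-- `J_s` is odd in `ω`: `∫_{(0,2a]} ρ(t) sin(−ω t) dt = −∫_{(0,2a]} ρ(t) sin(ω t) dt`. -/
theorem setIntegral_weilArchDensity_mul_sin_neg_freq (a ω : ℝ) :
    ∫ t in Ioc 0 (2 * a), weilArchDensity t * Real.sin (-ω * t)
      = -∫ t in Ioc 0 (2 * a), weilArchDensity t * Real.sin (ω * t) := by
  rw [← integral_neg]
  refine integral_congr_ae (Filter.Eventually.of_forall fun t ↦ ?_)
  simp only [neg_mul, Real.sin_neg, mul_neg]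

/-- `J_c` is even in `ω`: `∫_{(0,2a]} ρ(t)(1 − cos(−ω t)) dt = ∫_{(0,2a]} ρ(t)(1 − cos(ω t)) dt`. -/
theorem setIntegral_weilArchDensity_mul_one_sub_cos_neg_freq (a ω : ℝ) :
    ∫ t in Ioc 0 (2 * a), weilArchDensity t * (1 - Real.cos (-ω * t))
      = ∫ t in Ioc 0 (2 * a), weilArchDensity t * (1 - Real.cos (ω * t)) := by
  refine integral_congr_ae (Filter.Eventually.of_forall fun t ↦ ?_)
  simp only [neg_mul, Real.cos_neg]

/-- The prime sine sum `S` is odd in `ω`. -/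
theorem sum_vonMangoldt_sin_neg_freq (a ω : ℝ) :
    ∑ n ∈ weilPrimeIndex a, (Λ n : ℝ) / Real.sqrt n * Real.sin (-ω * Real.log n)
      = -∑ n ∈ weilPrimeIndex a, (Λ n : ℝ) / Real.sqrt n * Real.sin (ω * Real.log n) := by
  rw [← Finset.sum_neg_distrib]
  exact Finset.sum_congr rfl fun n _ ↦ by rw [neg_mul, Real.sin_neg, mul_neg]

/-- The prime cosine sum `C` is even in `ω`. -/
theorem sum_vonMangoldt_cos_neg_freq (a ω : ℝ) :
    ∑ n ∈ weilPrimeIndex a, (Λ n : ℝ) / Real.sqrt n * Real.cos (-ω * Real.log n)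
      = ∑ n ∈ weilPrimeIndex a, (Λ n : ℝ) / Real.sqrt n * Real.cos (ω * Real.log n) :=
  Finset.sum_congr rfl fun n _ ↦ by rw [neg_mul, Real.cos_neg]

end Summit.RiemannHypothesis.RiemannHypothesis.Theorems.WeilFormatC
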